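import Summits.QuantumFields.YangMills.Theorems.FlatTubeReductionProfileDressingPackage
import Summits.QuantumFields.YangMills.Theorems.FlatTubeReductionExactDressingOfCoreProfileSq
import HarnessLib

/-!
# THE PROFILE + DRESSING PACKAGE — FP RADIUS `β⁻¹`: `profileDressing_package` of `…ProfileDressingPackage` with the dressing built from the colour-localised kernel at Faddeev–Popov
# radius `β⁻¹` (lane A's weight of record; forced by the off-diagonal rate analysis `…DressedFixedBeta`: at `(√β)⁻¹` the near-pair colour smearing `(Bαδ₁ε)²` is `≍ β^{-1/3}log ≫ λ_b²`)
# (route `FlatTubeReduction`, crux K1 `NearFlatRatioLaw` stmt-QuantumFields-24720; seat `ym-line-ftr-p1` g15; rate twin «ratepack-v3 / frozen fibres»; R2b1 RECORD rung — no summit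
# statement is proved here)

WHY (PICKED.md g15; NOTES T5).  Identical wiring (F8e `exactDressing_of_coreProfile_sq` + F9g `normalisedProfile_package` + F8f `dressedWeight_fields_normalised`); only the weight inside
the exact diagonal ratio `f̂_β(u) = f_β(u)/f_β(1)`, `f_β(u) = fpBOKernel β Ω₀_β (fpWeight β⁻¹) u u / K₁^{(L³β)}(u,u)`, changes.
  ★★★★ `profileDressing_package_sq`.
HONEST FRAMING: wiring of landed bricks; femto rung R2b1 (RECORD label); not infinite volume, not a gap, not Clay.  No defs, no named facts, no `sorry`.
-/

set_option autoImplicit false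

noncomputable section

open MeasureTheory Filter Topology Real
open scoped BigOperators
open Literature.MathematicalPhysics.QuantumFieldTheory
open Literature.MathematicalPhysics.QuantumLattice

namespace Summit.QuantumFields.YangMills.Theorems.FemtoTransferGap.RateTube

open Summit.QuantumFields.YangMills.Theorems.FemtoTransferGap
open Summit.QuantumFields.YangMills.Theorems.FemtoTransferGap.TwoLattice
open Summit.QuantumFields.YangMills.Theorems.FemtoTransferGap.TwoLattice.ConstTube
open Summit.QuantumFields.YangMills.Theorems.FemtoTransferGap.TwoLattice.Avg
open Summit.QuantumFields.YangMills.Theorems.FemtoTransferGap.TwoLattice.Stiff (LinkSpace)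

variable {L : ℕ} [NeZero L]

/-- ★★★★ **THE PROFILE + DRESSING PACKAGE** (see the module docstring for the reading of each conjunct). [cite: Luscher1983, §3] -/
theorem profileDressing_package_sq (hL : Nonempty (NzSite L)) {D : ℝ} (hD : 0 ≤ D) {Ω₀ : ℝ → LinkSpace L → ℝ}
    (hΩm : ∀ β, Measurable (Ω₀ β)) (hΩ0 : ∀ β x, 0 ≤ Ω₀ β x) (hΩ1 : ∀ β x, Ω₀ β x ≤ 1) (hΩinv : ∀ β (g : SU2) (x : LinkSpace L), Ω₀ β (adL L g x) = Ω₀ β x)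
    (hΩs : ∀ β (v : Edge 3 L → Fin 3 → ℝ), Ω₀ β (linkEmbed L v) ≠ 0 →
      v ∈ capBalancedSet L ∧ ‖linkEmbed L v‖ ≤ (Real.sqrt β)⁻¹ ∧ ∀ (e : Edge 3 L) (c : Fin 3), |v e c| ≤ (Real.sqrt β)⁻¹)
    (hΩR : ∀ β x, Ω₀ β x ≠ 0 → ‖x‖ ≤ (Real.sqrt β)⁻¹)
    (hθ : ∀ᶠ β : ℝ in atTop, 0 < ∫ v, Ω₀ β (linkEmbed L v) ∂orthoTransverse L) (hγ : ∀ᶠ β in atTop, 0 < recordGamma L Ω₀ β) :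
    ∃ M₀ : ℝ, 2 ≤ M₀ ∧ ∀ M : ℝ, M₀ ≤ M → ∃ (n m W : ℝ → GaugeConfig 3 1 SU2 → ℝ) (γ ε : ℝ → ℝ) (κ : ℝ), 0 ≤ κ ∧
      -- profile fields
      (∀ β, Measurable (Function.uncurry fun u x => n β u * Ω₀ β x)) ∧ (∀ β u x, |n β u * Ω₀ β x| ≤ 1) ∧
      (∀ β (g : SU2) (u : GaugeConfig 3 1 SU2) (v : LinkSpace L), n β (gaugeTransform (fun _ : Site 3 1 => g) u) * Ω₀ β (adL L g v) = n β u * Ω₀ β v) ∧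
      (∀ β u x, n β u * Ω₀ β x ≠ 0 → ‖x‖ ≤ (Real.sqrt β)⁻¹) ∧
      -- exact fibre mass
      (∀ β, 0 < γ β) ∧
      (∀ᶠ β in atTop, ∀ u : GaugeConfig 3 1 SU2, orbitDist u < D * recordDelta1 L (1 / 6) β →
        fibreMassAd L (softWeight (recordChi L (1 / 6) (42 * D + 1) M β)) (fun u x => n β u * Ω₀ β x) u = γ β) ∧
      -- dressing fields
      (∀ β, IsPhys (W β)) ∧ (∀ β u, 0 ≤ W β u) ∧ (∀ β u, |W β u| ≤ Real.sqrt (1 + κ / 4)) ∧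
      (∀ β u, orbitDist u < D * recordDelta1 L (1 / 6) β → |W β u ^ 2 - 1| ≤ κ * orbitDist u ^ 2) ∧
      (∃ a' : ℝ, ∀ᶠ β in atTop, ε β ≤ a' * bareLambda ((L : ℝ) ^ 3 * β) ^ 2) ∧
      -- the window identities (eventually)
      (∀ᶠ β in atTop, ∀ u : GaugeConfig 3 1 SU2, orbitDist u < D * recordDelta1 L (1 / 6) β →
        |W β u ^ 2 - fpBOKernel L β (Ω₀ β) (fpWeight L β⁻¹) u u / transferKernel su2Rep ((L : ℝ) ^ 3 * β) u u /
            (fpBOKernel L β (Ω₀ β) (fpWeight L β⁻¹) 1 1 / transferKernel su2Rep ((L : ℝ) ^ 3 * β) (1 : GaugeConfig 3 1 SU2) 1) / m β u| ≤ ε β ∧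
        |m β u - 1| ≤ κ * orbitDist u ^ 2 + ε β ∧ 0 < m β u ∧ n β u ^ 2 * m β u = 1 / 2) := by
  -- F8: the exact dressing of the frozen profile
  obtain ⟨κ₀, hκ₀, εW, ⟨a', hεWa⟩, hεW0, -, -, -, hWsq, hWnear⟩ :=
    exactDressing_of_coreProfile_sq (L := L) hD Ω₀ (fun _ => 1) hΩm (fun β x => by rw [abs_of_nonneg (hΩ0 β x)]; exact hΩ1 β x) hΩ0 hΩinv hΩs hθ
  -- F9: the normalised profile
  obtain ⟨hR0, hRsmall, hR1⟩ := invSqrt_radius_eventually (L := L)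
  obtain ⟨M₀, hM₀, hpk⟩ := normalisedProfile_package hL hD hΩm (fun β x => by rw [abs_of_nonneg (hΩ0 β x)]; exact hΩ1 β x) hΩinv hΩR hR0 hRsmall hR1 hγ
  refine ⟨M₀, hM₀, fun M hM => ?_⟩
  obtain ⟨n, m, γ, κN, a, hκN, ha, hP1, hP2, hP3, hP4, hγpos, hN, hm_m, hm_g, hm_t, hmwin⟩ := hpk M hM
  -- the exact diagonal ratio family `f̂`
  obtain ⟨f, hfdef⟩ : ∃ f : ℝ → GaugeConfig 3 1 SU2 → ℝ, f = fun β u =>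
      fpBOKernel L β (Ω₀ β) (fpWeight L β⁻¹) u u / transferKernel su2Rep ((L : ℝ) ^ 3 * β) u u /
        (fpBOKernel L β (Ω₀ β) (fpWeight L β⁻¹) 1 1 / transferKernel su2Rep ((L : ℝ) ^ 3 * β) (1 : GaugeConfig 3 1 SU2) 1) := ⟨_, rfl⟩
  have hfβ : ∀ β, (fun u : GaugeConfig 3 1 SU2 => fpBOKernel L β (Ω₀ β) (fpWeight L β⁻¹) u u / transferKernel su2Rep ((L : ℝ) ^ 3 * β) u u /
      (fpBOKernel L β (Ω₀ β) (fpWeight L β⁻¹) 1 1 / transferKernel su2Rep ((L : ℝ) ^ 3 * β) (1 : GaugeConfig 3 1 SU2) 1)) = f β := fun β => by rw [hfdef]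
  have hfu : ∀ β (u : GaugeConfig 3 1 SU2), fpBOKernel L β (Ω₀ β) (fpWeight L β⁻¹) u u / transferKernel su2Rep ((L : ℝ) ^ 3 * β) u u /
      (fpBOKernel L β (Ω₀ β) (fpWeight L β⁻¹) 1 1 / transferKernel su2Rep ((L : ℝ) ^ 3 * β) (1 : GaugeConfig 3 1 SU2) 1) = f β u := fun β u => by rw [hfdef]
  have hCΩ : ∀ β x, |Ω₀ β x| ≤ 1 := fun β x => by rw [abs_of_nonneg (hΩ0 β x)]; exact hΩ1 β x
  have hfm : ∀ β, Measurable (f β) := fun β => by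
    rw [← hfβ]; exact (measurable_diagRatio β (hΩm β) (hCΩ β) (measurable_fpWeight L _) (abs_fpWeight_le L _)).div_const _
  have hfg : ∀ β (g : Site 3 1 → SU2) (u : GaugeConfig 3 1 SU2), f β (gaugeTransform g u) = f β u := fun β g u => by
    simp only [hfdef, diagRatio_gaugeTransform β (hΩm β) (hΩinv β) (measurable_fpWeight L _) (fun c g => fpWeight_conj _ c g) g u]
  have hft : ∀ β (k : Fin 3), ∀ z ∈ Subgroup.center SU2, ∀ u : GaugeConfig 3 1 SU2, f β (twist k z u) = f β u := fun β k z hz u => by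
    simp only [hfdef, diagRatio_twist β (Ω₀ β) (fpWeight L _) k hz u]
  have hf0 : ∀ β u, 0 ≤ f β u := fun β u => by
    simp only [hfdef]
    exact div_nonneg (diagRatio_nonneg β (hΩm β) (hCΩ β) (hΩ0 β) (measurable_fpWeight L _) (abs_fpWeight_le L _) (fun g => (fpWeight_mem_Icc L _ g).1) u)
      (diagRatio_nonneg β (hΩm β) (hCΩ β) (hΩ0 β) (measurable_fpWeight L _) (abs_fpWeight_le L _) (fun g => (fpWeight_mem_Icc L _ g).1) 1)
  -- the window radius and the smallness facts
  have hδt : Tendsto (fun β => D * recordDelta1 L (1 / 6) β) atTop (𝓝 0) := by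
    simpa using (tendsto_recordDelta1 (L := L) (by norm_num : (0 : ℝ) < 1 / 6)).const_mul D
  have hδ : ∀ᶠ β in atTop, D * recordDelta1 L (1 / 6) β ≤ 1 / 2 := hδt.eventually (eventually_le_nhds (by norm_num))
  have hεN0 : ∀ᶠ β : ℝ in atTop, 0 ≤ a * bareLambda ((L : ℝ) ^ 3 * β) ^ 2 := Filter.Eventually.of_forall fun β => mul_nonneg ha (sq_nonneg _)
  have hsmall : ∀ᶠ β in atTop, κN * (D * recordDelta1 L (1 / 6) β) ^ 2 + a * bareLambda ((L : ℝ) ^ 3 * β) ^ 2 ≤ 1 / 2 := by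
    filter_upwards [hδ, eventually_mul_le_of_tendsto hδt κN (by norm_num : (0:ℝ) < 1 / 4), mul_bareLambda_sq_eventually_le (L := L) ha] with β h1 h2 h3
    have h0 : 0 ≤ D * recordDelta1 L (1 / 6) β := mul_nonneg hD (by unfold recordDelta1; have := card_site_pos (L := L); have := powScale_pos (1 / 6) β; positivity)
    nlinarith
  -- F8's near-`1` estimate for `f̂` itself (clamp ± its slack)
  have hnear : ∀ᶠ β in atTop, ∀ u : GaugeConfig 3 1 SU2, orbitDist u < D * recordDelta1 L (1 / 6) β → 0 ≤ f β u ∧ |f β u - 1| ≤ κ₀ * orbitDist u ^ 2 + εW β := by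
    filter_upwards [hWnear] with β hWn u hu
    refine ⟨hf0 β u, ?_⟩
    have h1 := hWsq β u hu
    have h2 := hWn u hu
    rw [hfβ β] at h1
    rw [hfβ β, hfu β u] at h2
    have e : f β u - 1 = (clampW κ₀ (f β) (fun U : GaugeConfig 3 1 SU2 => min (torDist U) (1 / 2)) u ^ 2 - 1) -
        (clampW κ₀ (f β) (fun U : GaugeConfig 3 1 SU2 => min (torDist U) (1 / 2)) u ^ 2 - f β u) := by ring
    rw [e]
    exact (abs_sub _ _).trans (by linarith)
  have hmnear : ∀ᶠ β in atTop, ∀ u : GaugeConfig 3 1 SU2, orbitDist u < D * recordDelta1 L (1 / 6) β → |m β u - 1| ≤ κN * orbitDist u ^ 2 + a * bareLambda ((L : ℝ) ^ 3 * β) ^ 2 := by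
    filter_upwards [hmwin] with β h u hu using (h u hu).1
  -- F8f: the dressed weight of the quotient
  obtain ⟨hphys, hW0, hWb, hWsq', hWn'⟩ := dressedWeight_fields_normalised (f := f) (m := m) hfm hfg hft hm_m hm_g hm_t
    (δ₁ := fun β => D * recordDelta1 L (1 / 6) β) (εW := εW) (εN := fun β => a * bareLambda ((L : ℝ) ^ 3 * β) ^ 2) (κ₀ := κ₀) (κN := κN) (κ := 2 * (κ₀ + κN))
    le_rfl (by positivity) hκN hδ hεW0 hεN0 hsmall hnear hmnear
  refine ⟨n, m, fun β => clampW (2 * (κ₀ + κN)) (fun u => f β u / m β u) (fun U : GaugeConfig 3 1 SU2 => min (torDist U) (1 / 2)), γ,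
    fun β => 2 * (εW β + a * bareLambda ((L : ℝ) ^ 3 * β) ^ 2), 2 * (κ₀ + κN), by positivity, hP1, hP2, hP3, hP4, hγpos, hN, hphys, hW0, hWb, hWsq',
    ⟨2 * a' + 2 * a, ?_⟩, ?_⟩
  · filter_upwards [hεWa] with β h
    nlinarith [sq_nonneg (bareLambda ((L : ℝ) ^ 3 * β))]
  · filter_upwards [hWn', hmwin, hεW0] with β hW hmw hε0 u hu
    obtain ⟨hm1, hm0, hnm⟩ := hmw u hu
    refine ⟨?_, ?_, hm0, hnm⟩
    · rw [hfu β u]; exact hW u hu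
    · have hsq := sq_nonneg (bareLambda ((L : ℝ) ^ 3 * β))
      have hd := sq_nonneg (orbitDist u)
      nlinarith [hm1, mul_nonneg hκ₀ hd, mul_nonneg ha hsq]

end Summit.QuantumFields.YangMills.Theorems.FemtoTransferGap.RateTube

end
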